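import Summits.BirchSwinnertonDyer.Rank1Residual.X2.TateLineDecomposition
import Summits.BirchSwinnertonDyer.Rank1Residual.X1.CongruenceTransfer
import Literature.NumberTheory.EllipticCurves.Rank1Residual.AnomalousDictionaryPrimesAboveProofs
import Literature.NumberTheory.EllipticCurves.Rank1Residual.GVParityTransferProofs
import Literature.NumberTheory.GaloisRepresentations.DecompositionGroupOfCompletion
import HarnessLib

/-!
# Class X2 (odd multiplicative Eisenstein prime): the GOOD relative of a congruence `E₀[p] ≅ E₀'[p]`
# is NON-ANOMALOUS when `E₀` is NON-SPLIT at `p`, and ANOMALOUS when `E₀` is SPLIT at `p`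
# (cell `b2b-bsdres`, unit `b2b-bsdres-eisenstein-p2`, gen 15)

HONEST FRAMING (run/shared/lean/b2b/bsd-rank1-residual/, verbatim in every file): the goal of the
cell is to DELETE the COMBINATION-SHAPED residual classes of the Birch–Swinnerton-Dyer formula for
ALL analytic-rank `≤ 1` elliptic curves over `ℚ` — "full BSD formula for every rank `≤ 1` curve in
class `C`" assembled STRICTLY from published theorems — so that the rank-`≤ 1` remainder becomes
exactly the CONSTRUCTION-SHAPED classes, which are TYPED (missing-input `Prop`s), NOT attempted.
This is not "finishing BSD". Research route; NO CLAIM BEYOND STATED CLASSES; nothing here changes a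
label. Theorems only (no definition, no named fact, nothing asserted).

## What this file proves (gen-14 successor item (i), X2-GAP §19.5 (4))

Route G with a COVERED partner (gen 14, `X2/CongruenceTransferCovered(Nonsplit).lean`) closes
Mazur's main conjecture at an X2 pair `(E₀, p)` from a congruent GOOD relative `E₀'`
(`E₀[p] ≅ E₀'[p]` as `Γ_ℚ`-modules, `TorsionIso`) whose main conjecture is Castella–Grossi–Skinner
2025 Thm. A — which needs the relative to be NON-ANOMALOUS, `a_p(E₀') ≢ 1 (mod p)`, so far a per-pair
hypothesis `hna'` (decided from Cremona's `a_p`). Here that hypothesis is DISCHARGED BY THE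
CONGRUENCE at a NON-SPLIT `p`, and shown to FAIL IDENTICALLY at a SPLIT `p`:

* `not_dvd_frobeniusTrace_sub_one_of_torsionIso_of_not_split` — `E₀` NON-SPLIT multiplicative at
  the odd prime `p`, `E₀[p]` reducible, `E₀'` good at `p`, `E₀[p] ≅ E₀'[p]` ⟹ `p ∤ a_p(E₀') − 1`
  (the relative is non-anomalous; with `not_hasIrreducibleModPGaloisRep_of_torsionIso` and Serre's
  Prop. 12 it is a good ORDINARY non-anomalous Eisenstein pair — CGS's hypothesis on the nose).
* `dvd_frobeniusTrace_sub_one_of_torsionIso_of_split` — `E₀` SPLIT multiplicative at `p`, `E₀[p]`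
  reducible, `E₀'` good at `p`, `E₀[p] ≅ E₀'[p]` ⟹ `p ∣ a_p(E₀') − 1`: EVERY good relative of a
  split X2 pair is ANOMALOUS (an X1-leaf pair), so no published main conjecture is available on its
  congruence class — the covered-partner route is EXACTLY the non-split sub-cell (kernel form of
  X2-GAP §19.1/§19.5 (3)).
* `split_iff_split_of_torsionIso` — two MULTIPLICATIVE members of a congruence are split or non-split
  TOGETHER (`p` odd): the trivial-zero order `e_p` is a congruence invariant (the `± e_p` terms of gen
  13's mult–mult shift `k = k' + Σ(δ'−δ) + e_p(E₀') − e_p(E₀)` cancel).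

Mechanism: x1a's kernel dictionary at ANY prime above `p`
(`Rank1Residual.anom_iff_decomposition_of_mem_primesAbove`, Serre 1972 §1.11: for a good `p > 2` and
a rational line `Φ'`, `a_p ≡ 1 (mod p)` iff the decomposition group fixes `Φ'` pointwise or acts
trivially on `E'[p]/Φ'`), taken at the prime `𝔓₀ = adicCompletionPrime ℚ v` of the tree's chosen
embedding (`D_{𝔓₀} = decomp v`, `decompositionSubgroup_adicCompletionPrime_eq_range`); the two
clauses are transported along the `Γ_ℚ`-isomorphism `e : E₀[p] ≅ E₀'[p]` (`forall_fix_map_iff`,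
`forall_quot_map_iff`); and on `E₀[p]` they are decided by the Tate datum
(`TateLineDecomposition.not_fix_and_not_quot_of_not_split` / `fix_or_quot_of_split`, granted the
PUBLISHED Tate uniformisation A40/A41, Silverman *ATAEC* V.5.3/5.4 — already hypotheses of every
`_of_facts` form of route G).

References: [Serre1972] §1.11 (1), Prop. 11–12, §1.12; [GreenbergVatsal2000] §2 pp. 14–15 and Thm.
(1.4); [CastellaGrossiSkinner2025] Thm. A (hypothesis "`φ|_{G_p} ≠ 1, ω`"), §0 p. 3;
[SilvermanATAEC1994] Ch. V Lemma 5.2 (c), Thm. 5.3, Cor. 5.4; HOME/b2b-bsdres-eisenstein-p2/X2-GAP.md §20.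
-/

set_option autoImplicit false

noncomputable section

open scoped Classical

open NumberField IsDedekindDomain Field WeierstrassCurve
  Literature.NumberTheory.EllipticCurves Literature.NumberTheory.GaloisRepresentations
  Literature.NumberTheory.EllipticCurves.GreenbergSelmer
  Literature.NumberTheory.EllipticCurves.Rank1Residual
  Summit.BirchSwinnertonDyer.Rank1Residual.X1.CongruenceTransfer

namespace Summit.BirchSwinnertonDyer.Rank1Residual.X2.CongruentPartnerAnomalous

variable {W W' : WeierstrassCurve ℚ} [W.IsElliptic] [W.IsGloballyMinimal] [W'.IsElliptic]
  [W'.IsGloballyMinimal] {p : ℕ} [hp : Fact p.Prime]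

/-! ## §1. Transport of the two decomposition clauses along `e : E₀[p] ≅ E₀'[p]` -/

section Transport

variable (e : geomTorsion W (p : ℤ) ≃+ geomTorsion W' (p : ℤ))
  (he : ∀ (σ : absoluteGaloisGroup ℚ) (P : geomTorsion W (p : ℤ)), e (σ • P) = σ • e P)
  (D : Subgroup (absoluteGaloisGroup ℚ)) (Φ : AddSubgroup (geomTorsion W (p : ℤ)))

omit [W.IsElliptic] [W.IsGloballyMinimal] [W'.IsElliptic] [W'.IsGloballyMinimal] hp in
include he in
/-- "`D` fixes the line pointwise" is transported by a `Γ_ℚ`-isomorphism `E₀[p] ≅ E₀'[p]`.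
[folklore] -/
theorem forall_fix_map_iff :
    (∀ g ∈ D, ∀ P ∈ Φ.map e.toAddMonoidHom, g • P = P) ↔ (∀ g ∈ D, ∀ P ∈ Φ, g • P = P) := by
  constructor
  · intro h g hg P hP
    have h1 := h g hg (e P) (AddSubgroup.mem_map.mpr ⟨P, hP, rfl⟩)
    rw [← he] at h1
    exact e.injective h1
  · intro h g hg Q hQ
    obtain ⟨P, hP, rfl⟩ := AddSubgroup.mem_map.mp hQ
    change g • e P = e P
    rw [← he, h g hg P hP]

omit [W.IsElliptic] [W.IsGloballyMinimal] [W'.IsElliptic] [W'.IsGloballyMinimal] hp in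
include he in
/-- "`D` acts trivially on `E[p]/Φ`" is transported by a `Γ_ℚ`-isomorphism `E₀[p] ≅ E₀'[p]`.
[folklore] -/
theorem forall_quot_map_iff :
    (∀ g ∈ D, ∀ Q : geomTorsion W' (p : ℤ), g • Q - Q ∈ Φ.map e.toAddMonoidHom) ↔
      (∀ g ∈ D, ∀ P : geomTorsion W (p : ℤ), g • P - P ∈ Φ) := by
  constructor
  · intro h g hg P
    have h1 := h g hg (e P)
    rw [← he, ← map_sub] at h1
    obtain ⟨R, hR, hRe⟩ := AddSubgroup.mem_map.mp h1
    have hR' : R = g • P - P := e.injective hRe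
    rw [← hR']
    exact hR
  · intro h g hg Q
    obtain ⟨P, rfl⟩ := e.surjective Q
    rw [← he, ← map_sub]
    exact AddSubgroup.mem_map.mpr ⟨g • P - P, h g hg P, rfl⟩

omit [W.IsElliptic] [W.IsGloballyMinimal] [W'.IsElliptic] [W'.IsGloballyMinimal] in
include he in
/-- The image of a rational line under a `Γ_ℚ`-isomorphism is a rational line (x1a's
`isRationalLine_map`). [folklore] -/
theorem isRationalLine_map_equiv {Φ : AddSubgroup (geomTorsion W (p : ℤ))} (hΦ : IsRationalLine W p Φ) :
    IsRationalLine W' p (Φ.map e.toAddMonoidHom) :=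
  isRationalLine_map e.toAddMonoidHom he hΦ fun P _ h ↦ by
    have h' : e P = e 0 := by rw [map_zero]; exact h
    exact e.injective h'

end Transport

/-! ## §2. Small bookkeeping: the place `v ∋ p`, reducibility from a rational line -/

omit [W.IsGloballyMinimal] hp in
/-- A curve with a rational `p`-line is reducible at `p`. [folklore] -/
theorem not_hasIrreducibleModPGaloisRep_of_isRationalLine [Fact p.Prime]
    {Φ : AddSubgroup (geomTorsion W (p : ℤ))} (hΦ : IsRationalLine W p Φ) :
    ¬ W.HasIrreducibleModPGaloisRep p := by
  intro hirr
  rcases hirr Φ hΦ.2 with h | h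
  · have := hΦ.1
    rw [h, AddSubgroup.card_bot] at this
    exact (Fact.out : p.Prime).one_lt.ne this
  · have h1 := hΦ.1
    rw [h, AddSubgroup.card_top, Literature.NumberTheory.EllipticCurves.natCard_geomTorsion W p] at h1
    have : p ^ 2 = p ^ 1 := by rw [pow_one]; exact h1
    exact absurd (Nat.pow_right_injective (Fact.out : p.Prime).two_le this) (by norm_num)

/-- Membership in the decomposition group of `𝔓₀ = adicCompletionPrime ℚ v` is membership in
`decomp v` (`decompositionSubgroup_adicCompletionPrime_eq_range`). [cite: NeukirchANT1999, Ch. II §9 Prop. (9.6)] -/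
theorem mem_decompositionSubgroup_adicCompletionPrime_iff (v : HeightOneSpectrum (𝓞 ℚ))
    (g : absoluteGaloisGroup ℚ) :
    g ∈ (adicCompletionPrime ℚ v).decompositionSubgroup (absoluteGaloisGroup ℚ) ↔
      g ∈ decomp (K := ℚ) v := by
  rw [decompositionSubgroup_adicCompletionPrime_eq_range]
  rfl

/-! ## §3. NON-SPLIT: the good relative is NON-ANOMALOUS -/

/-- **NON-SPLIT X2 pair ⇒ the good congruent relative is NON-ANOMALOUS.** `W, W'/ℚ` globally
minimal elliptic, `p` odd; `W` has NON-SPLIT multiplicative reduction at `p` with `W[p]` reducible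
(an X2 pair), `W'` has GOOD reduction at `p`, and `e : W[p] ≅ W'[p]` is a `Γ_ℚ`-isomorphism. Then
`p ∤ a_p(W') − 1`. Proof: `W'` is reducible (image of a rational line); if `a_p(W') ≡ 1`, x1a's
dictionary at `𝔓₀ = adicCompletionPrime ℚ v` gives "`D_v` fixes `Φ'` or is trivial on `W'[p]/Φ'`";
transported to `W[p]` this contradicts `TateLineDecomposition.not_fix_and_not_quot_of_not_split`.
Granted A41 (`hT`, twisted Tate uniformisation). [cite: Serre1972, §1.11 (1), Prop. 11–12]
[cite: GreenbergVatsal2000, §2 pp. 14–15]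
[cite: SilvermanATAEC1994, Ch. V Lemma 5.2 (c), Thm. 5.3 (a),(b), Cor. 5.4 (held copy PDF pp. 406–410)] -/
theorem not_dvd_frobeniusTrace_sub_one_of_equiv_of_not_split
    (hT : Silverman1994_thmV53_corV54_tateUniformisation.{0}) (hp2 : p ≠ 2)
    (hmult : W.HasMultiplicativeReductionAtPrime p)
    (hns : ¬ W.HasSplitMultiplicativeReductionAtPrime p) (hred : ¬ W.HasIrreducibleModPGaloisRep p)
    (hgood' : W'.HasGoodReductionAtPrime p)
    (e : geomTorsion W (p : ℤ) ≃+ geomTorsion W' (p : ℤ))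
    (he : ∀ (σ : absoluteGaloisGroup ℚ) (P : geomTorsion W (p : ℤ)), e (σ • P) = σ • e P) :
    ¬ (p : ℤ) ∣ W'.frobeniusTrace p - 1 := by
  intro hdvd
  have hpp := hp.out
  have hp2' : 2 < p := lt_of_le_of_ne hpp.two_le (Ne.symm hp2)
  -- the place of `ℚ` above `p`
  set v : HeightOneSpectrum (𝓞 ℚ) := (Rat.HeightOneSpectrum.primesEquiv).symm ⟨p, hpp⟩ with hvdef
  have hv : (Rat.HeightOneSpectrum.primesEquiv v : ℕ) = p := by
    rw [hvdef, Equiv.apply_symm_apply]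
  have hpv : ((p : ℕ) : 𝓞 ℚ) ∈ v.asIdeal := natCast_mem_asIdeal_of_primesEquiv_eq hv
  -- a rational line of `W` and its image in `W'[p]`
  obtain ⟨Φ, hΦ⟩ := exists_isRationalLine_of_not_irr W p hred
  have hΦ' : IsRationalLine W' p (Φ.map e.toAddMonoidHom) := isRationalLine_map_equiv e he hΦ
  have hred' : ¬ W'.HasIrreducibleModPGaloisRep p := not_hasIrreducibleModPGaloisRep_of_isRationalLine hΦ'
  have hanom : Anom W' p := ⟨hred', hgood', hdvd⟩
  -- the dictionary at `𝔓₀`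
  have h𝔓 := adicCompletionPrime_mem_primesAbove ℚ v
  have hdict := (anom_iff_decomposition_of_mem_primesAbove hp2' hgood' hv h𝔓 hΦ').mp hanom
  -- the `E₀` side
  obtain ⟨hnfix, hnquot⟩ :=
    TateLineDecomposition.not_fix_and_not_quot_of_not_split W p hT hp2 hmult hns hpv hΦ.1
  rcases hdict with hfix | hquot
  · refine hnfix ((forall_fix_map_iff e he (decomp (K := ℚ) v) Φ).mp fun g hg P hP ↦ ?_)
    exact hfix g ((mem_decompositionSubgroup_adicCompletionPrime_iff v g).mpr hg) P hP
  · refine hnquot ((forall_quot_map_iff e he (decomp (K := ℚ) v) Φ).mp fun g hg Q ↦ ?_)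
    exact hquot g ((mem_decompositionSubgroup_adicCompletionPrime_iff v g).mpr hg) Q

/-- **The same from `TorsionIso W W' p`** (route G's congruence predicate, X1/CongruenceTransfer):
at a NON-SPLIT X2 pair the good relative has `p ∤ a_p − 1` — the `hna'` binder of gen 14's
`mazurMainConjectureAt_of_coveredRelative_of_not_split` / `bsdp_of_coveredRelative_rankZero_of_not_split`
is DISCHARGED by the congruence. [cite: Serre1972, §1.11 (1), Prop. 11–12]
[cite: GreenbergVatsal2000, Thm. (1.4) and §2 pp. 14–15] -/
theorem not_dvd_frobeniusTrace_sub_one_of_torsionIso_of_not_split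
    (hT : Silverman1994_thmV53_corV54_tateUniformisation.{0}) (hp2 : p ≠ 2)
    (hmult : W.HasMultiplicativeReductionAtPrime p)
    (hns : ¬ W.HasSplitMultiplicativeReductionAtPrime p) (hred : ¬ W.HasIrreducibleModPGaloisRep p)
    (hgood' : W'.HasGoodReductionAtPrime p) (hiso : TorsionIso W W' p) :
    ¬ (p : ℤ) ∣ W'.frobeniusTrace p - 1 := by
  obtain ⟨e, he⟩ := hiso
  exact not_dvd_frobeniusTrace_sub_one_of_equiv_of_not_split hT hp2 hmult hns hred hgood' e he

/-- **NON-SPLIT X2 pair: the good relative is a COVERED pair** — good, reducible (Eisenstein),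
ordinary (Serre Prop. 12, tree `goodOrd_of_red_of_good`) and non-anomalous: exactly the hypotheses
of Castella–Grossi–Skinner 2025 Thm. A, all read off the congruence. [cite: Serre1972, §1.11 Prop. 12]
[cite: CastellaGrossiSkinner2025, Thm. A (hypothesis on φ), §0 p. 3] -/
theorem covered_partner_of_torsionIso_of_not_split
    (hT : Silverman1994_thmV53_corV54_tateUniformisation.{0}) (hp2 : p ≠ 2)
    (hmult : W.HasMultiplicativeReductionAtPrime p)
    (hns : ¬ W.HasSplitMultiplicativeReductionAtPrime p) (hred : ¬ W.HasIrreducibleModPGaloisRep p)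
    (hgood' : W'.HasGoodReductionAtPrime p) (hiso : TorsionIso W W' p) :
    ¬ W'.HasIrreducibleModPGaloisRep p ∧ ¬ (p : ℤ) ∣ W'.frobeniusTrace p ∧
      ¬ (p : ℤ) ∣ W'.frobeniusTrace p - 1 := by
  have hp2' : 2 < p := lt_of_le_of_ne hp.out.two_le (Ne.symm hp2)
  obtain ⟨e, he⟩ := hiso
  have hred' : ¬ W'.HasIrreducibleModPGaloisRep p := fun h ↦ by
    obtain ⟨Φ, hΦ⟩ := exists_isRationalLine_of_not_irr W p hred
    exact not_hasIrreducibleModPGaloisRep_of_isRationalLine (isRationalLine_map_equiv e he hΦ) h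
  exact ⟨hred', (goodOrd_of_red_of_good W' p hp2' hgood' hred').2,
    not_dvd_frobeniusTrace_sub_one_of_equiv_of_not_split hT hp2 hmult hns hred hgood' e he⟩

/-! ## §4. SPLIT: the good relative is ANOMALOUS -/

omit [W.IsGloballyMinimal] in
/-- **SPLIT X2 pair ⇒ every good congruent relative is ANOMALOUS.** `W, W'/ℚ` globally minimal
elliptic, `p` odd; `W` has SPLIT multiplicative reduction at `p` with `W[p]` reducible, `W'` has GOOD
reduction at `p`, `e : W[p] ≅ W'[p]` a `Γ_ℚ`-isomorphism. Then `p ∣ a_p(W') − 1`. Proof: a rational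
line `Φ` of `W` is `D_v`-stable; `TateLineDecomposition.fix_or_quot_of_split` gives "`D_v` fixes `Φ`
or is trivial on `W[p]/Φ`"; transported to `W'[p]` this is the right-hand side of x1a's dictionary.
Granted A40 (`hT`). Consequence: the congruence class of a split X2 pair contains no covered (C6)
pair — its good members are X1-leaf pairs. [cite: Serre1972, §1.11 (1), Prop. 11–12]
[cite: GreenbergVatsal2000, §2 pp. 14–15]
[cite: SilvermanATAEC1994, Ch. V Thm. 3.1 (c),(d) p. 423 and §V.5 Thm. 5.3 (a),(b)] -/
theorem dvd_frobeniusTrace_sub_one_of_equiv_of_split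
    (hT : Silverman1994_thmV53_tateUniformisation.{0}) (hp2 : p ≠ 2)
    (hsplit : W.HasSplitMultiplicativeReductionAtPrime p) (hred : ¬ W.HasIrreducibleModPGaloisRep p)
    (hgood' : W'.HasGoodReductionAtPrime p)
    (e : geomTorsion W (p : ℤ) ≃+ geomTorsion W' (p : ℤ))
    (he : ∀ (σ : absoluteGaloisGroup ℚ) (P : geomTorsion W (p : ℤ)), e (σ • P) = σ • e P) :
    (p : ℤ) ∣ W'.frobeniusTrace p - 1 := by
  have hpp := hp.out
  have hp2' : 2 < p := lt_of_le_of_ne hpp.two_le (Ne.symm hp2)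
  set v : HeightOneSpectrum (𝓞 ℚ) := (Rat.HeightOneSpectrum.primesEquiv).symm ⟨p, hpp⟩ with hvdef
  have hv : (Rat.HeightOneSpectrum.primesEquiv v : ℕ) = p := by
    rw [hvdef, Equiv.apply_symm_apply]
  have hpv : ((p : ℕ) : 𝓞 ℚ) ∈ v.asIdeal := natCast_mem_asIdeal_of_primesEquiv_eq hv
  obtain ⟨Φ, hΦ⟩ := exists_isRationalLine_of_not_irr W p hred
  have hΦ' : IsRationalLine W' p (Φ.map e.toAddMonoidHom) := isRationalLine_map_equiv e he hΦ
  have h𝔓 := adicCompletionPrime_mem_primesAbove ℚ v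
  have hE := TateLineDecomposition.fix_or_quot_of_split W p hT hsplit hpv hΦ.1
    (fun g _ P hP ↦ hΦ.2 g P hP)
  have hanom : Anom W' p := by
    refine (anom_iff_decomposition_of_mem_primesAbove hp2' hgood' hv h𝔓 hΦ').mpr ?_
    rcases hE with hfix | hquot
    · left
      intro g hg Q hQ
      exact (forall_fix_map_iff e he (decomp (K := ℚ) v) Φ).mpr hfix g
        ((mem_decompositionSubgroup_adicCompletionPrime_iff v g).mp hg) Q hQ
    · right
      intro g hg Q
      exact (forall_quot_map_iff e he (decomp (K := ℚ) v) Φ).mpr hquot g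
        ((mem_decompositionSubgroup_adicCompletionPrime_iff v g).mp hg) Q
  exact hanom.2.2

omit [W.IsGloballyMinimal] in
/-- **The same from `TorsionIso W W' p`**: a good relative of a SPLIT X2 pair is an ANOMALOUS
Eisenstein pair (X1 leaf) — Castella–Grossi–Skinner 2025 Thm. A does not apply anywhere on the
congruence class; the covered-partner route G of gen 14 is exactly the NON-SPLIT sub-cell.
[cite: Serre1972, §1.11 (1), Prop. 11–12] [cite: GreenbergVatsal2000, Thm. (1.4) and §2 pp. 14–15] -/
theorem dvd_frobeniusTrace_sub_one_of_torsionIso_of_split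
    (hT : Silverman1994_thmV53_tateUniformisation.{0}) (hp2 : p ≠ 2)
    (hsplit : W.HasSplitMultiplicativeReductionAtPrime p) (hred : ¬ W.HasIrreducibleModPGaloisRep p)
    (hgood' : W'.HasGoodReductionAtPrime p) (hiso : TorsionIso W W' p) :
    (p : ℤ) ∣ W'.frobeniusTrace p - 1 := by
  obtain ⟨e, he⟩ := hiso
  exact dvd_frobeniusTrace_sub_one_of_equiv_of_split hT hp2 hsplit hred hgood' e he

/-! ## §5. Splitness at an odd `p` is a congruence invariant -/

omit [W'.IsGloballyMinimal] in
/-- **A curve congruent mod `p` to a NON-SPLIT multiplicative one is not SPLIT multiplicative at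
`p`** (`p` odd, `W[p]` reducible): if `W'` were split, `TateLineDecomposition.fix_or_quot_of_split`
for `W'` at the image `Φ'` of a rational line `Φ` of `W`, transported back along `e`, would contradict
`not_fix_and_not_quot_of_not_split` for `W`. With `split_of_equiv_of_split` below: for two
multiplicative members of a route-G pair the trivial-zero orders agree, `e_p(E₀) = e_p(E₀')` (the
`± e_p` terms of gen 13's mult–mult shift cancel). Granted A40 (`hT'`) and A41 (`hT`).
[cite: GreenbergVatsal2000, §2 pp. 14–15]
[cite: SilvermanATAEC1994, Ch. V Lemma 5.2 (c), Thm. 5.3 (a),(b), Cor. 5.4 (held copy PDF pp. 406–410)] -/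
theorem not_split_of_equiv_of_not_split
    (hT : Silverman1994_thmV53_corV54_tateUniformisation.{0})
    (hT' : Silverman1994_thmV53_tateUniformisation.{0}) (hp2 : p ≠ 2)
    (hmult : W.HasMultiplicativeReductionAtPrime p)
    (hns : ¬ W.HasSplitMultiplicativeReductionAtPrime p) (hred : ¬ W.HasIrreducibleModPGaloisRep p)
    (e : geomTorsion W (p : ℤ) ≃+ geomTorsion W' (p : ℤ))
    (he : ∀ (σ : absoluteGaloisGroup ℚ) (P : geomTorsion W (p : ℤ)), e (σ • P) = σ • e P) :
    ¬ W'.HasSplitMultiplicativeReductionAtPrime p := by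
  intro hsplit'
  have hpp := hp.out
  set v : HeightOneSpectrum (𝓞 ℚ) := (Rat.HeightOneSpectrum.primesEquiv).symm ⟨p, hpp⟩ with hvdef
  have hv : (Rat.HeightOneSpectrum.primesEquiv v : ℕ) = p := by
    rw [hvdef, Equiv.apply_symm_apply]
  have hpv : ((p : ℕ) : 𝓞 ℚ) ∈ v.asIdeal := natCast_mem_asIdeal_of_primesEquiv_eq hv
  obtain ⟨Φ, hΦ⟩ := exists_isRationalLine_of_not_irr W p hred
  have hΦ' : IsRationalLine W' p (Φ.map e.toAddMonoidHom) := isRationalLine_map_equiv e he hΦ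
  obtain ⟨hnfix, hnquot⟩ :=
    TateLineDecomposition.not_fix_and_not_quot_of_not_split W p hT hp2 hmult hns hpv hΦ.1
  rcases TateLineDecomposition.fix_or_quot_of_split W' p hT' hsplit' hpv hΦ'.1
      (fun g _ Q hQ ↦ hΦ'.2 g Q hQ) with hfix | hquot
  · exact hnfix ((forall_fix_map_iff e he (decomp (K := ℚ) v) Φ).mp hfix)
  · exact hnquot ((forall_quot_map_iff e he (decomp (K := ℚ) v) Φ).mp hquot)

omit [W.IsGloballyMinimal] in
/-- **A MULTIPLICATIVE curve congruent mod `p` to a SPLIT multiplicative one is SPLIT at `p`**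
(`p` odd, `W[p]` reducible). Granted A40 (`hT'`) and A41 (`hT`).
[cite: GreenbergVatsal2000, §2 pp. 14–15]
[cite: SilvermanATAEC1994, Ch. V Lemma 5.2 (c), Thm. 5.3 (a),(b), Cor. 5.4 (held copy PDF pp. 406–410)] -/
theorem split_of_equiv_of_split
    (hT : Silverman1994_thmV53_corV54_tateUniformisation.{0})
    (hT' : Silverman1994_thmV53_tateUniformisation.{0}) (hp2 : p ≠ 2)
    (hsplit : W.HasSplitMultiplicativeReductionAtPrime p) (hred : ¬ W.HasIrreducibleModPGaloisRep p)
    (hmult' : W'.HasMultiplicativeReductionAtPrime p)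
    (e : geomTorsion W (p : ℤ) ≃+ geomTorsion W' (p : ℤ))
    (he : ∀ (σ : absoluteGaloisGroup ℚ) (P : geomTorsion W (p : ℤ)), e (σ • P) = σ • e P) :
    W'.HasSplitMultiplicativeReductionAtPrime p := by
  by_contra hns'
  have hpp := hp.out
  set v : HeightOneSpectrum (𝓞 ℚ) := (Rat.HeightOneSpectrum.primesEquiv).symm ⟨p, hpp⟩ with hvdef
  have hv : (Rat.HeightOneSpectrum.primesEquiv v : ℕ) = p := by
    rw [hvdef, Equiv.apply_symm_apply]
  have hpv : ((p : ℕ) : 𝓞 ℚ) ∈ v.asIdeal := natCast_mem_asIdeal_of_primesEquiv_eq hv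
  obtain ⟨Φ, hΦ⟩ := exists_isRationalLine_of_not_irr W p hred
  have hΦ' : IsRationalLine W' p (Φ.map e.toAddMonoidHom) := isRationalLine_map_equiv e he hΦ
  obtain ⟨hnfix, hnquot⟩ :=
    TateLineDecomposition.not_fix_and_not_quot_of_not_split W' p hT hp2 hmult' hns' hpv hΦ'.1
  rcases TateLineDecomposition.fix_or_quot_of_split W p hT' hsplit hpv hΦ.1
      (fun g _ P hP ↦ hΦ.2 g P hP) with hfix | hquot
  · exact hnfix ((forall_fix_map_iff e he (decomp (K := ℚ) v) Φ).mpr hfix)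
  · exact hnquot ((forall_quot_map_iff e he (decomp (K := ℚ) v) Φ).mpr hquot)

/-- **`TorsionIso` form: the two multiplicative members of a route-G pair are split or non-split
TOGETHER** (`p` odd, Eisenstein): `W.Split p ↔ W'.Split p`. [cite: GreenbergVatsal2000, Thm. (1.4) and §2 pp. 14–15] -/
theorem split_iff_split_of_torsionIso
    (hT : Silverman1994_thmV53_corV54_tateUniformisation.{0})
    (hT' : Silverman1994_thmV53_tateUniformisation.{0}) (hp2 : p ≠ 2)
    (hmult : W.HasMultiplicativeReductionAtPrime p) (hmult' : W'.HasMultiplicativeReductionAtPrime p)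
    (hred : ¬ W.HasIrreducibleModPGaloisRep p) (hiso : TorsionIso W W' p) :
    W.HasSplitMultiplicativeReductionAtPrime p ↔ W'.HasSplitMultiplicativeReductionAtPrime p := by
  obtain ⟨e, he⟩ := hiso
  refine ⟨fun hs ↦ split_of_equiv_of_split hT hT' hp2 hs hred hmult' e he, fun hs' ↦ ?_⟩
  by_contra hns
  exact not_split_of_equiv_of_not_split hT hT' hp2 hmult hns hred e he hs'

end Summit.BirchSwinnertonDyer.Rank1Residual.X2.CongruentPartnerAnomalous

end
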